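import Summits.BirchSwinnertonDyer.BirchSwinnertonDyer.Theorems.SchneiderFreeAdditiveX3ControlLeDoor
import Summits.BirchSwinnertonDyer.BirchSwinnertonDyer.Theorems.SchneiderFreeAdditiveX3BranchIMCHalves
import HarnessLib

/-!
# Route `SchneiderFreeAdditiveX3` (rung K1 door): the MINIMAL fact set of the door — CTL₀ and the control
# inequality from Poitou–Tate duality and Kolyvagin alone; the leaf modulo `PrintedFacts`, one duality, and
# the typed analytic halves of the two branch cruxes

Seat `bsd-schneider-door-c4`, gen 4 (cell `bsd-schneider-ideate`); sequel of `…ControlLeDoor.lean` (p447721: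
the leaf consumes control only as the INEQUALITY `SchneiderFreeControlAtoms.AdditiveControlLeOnTreeAt … 0 P`,
proved there at every frame WITHOUT Fin_v). Two further inputs are idle: (L10) `CoinvariantsTrivialAt` (the
only consumer of `poitouTate_sha_tateDual`) — an inequality needs only `p^n · #Sel_γ = #Sel^γ ≤ …`, the torsion
clause and the witness `n` coming from the finiteness of `Sel^γ` (X11b `XAc.exists_hasCharValuationAt_of_finite`);
and the branch cruxes' typed-halves roads (`SchneiderFree.additiveIMCLowerBDPInputManinAt_of_halves`) consume
control only as CTL₀ = "`∃ n, HasCharValuationAt … n`". Content (CONDITIONAL, hypotheses BY NAME; no `sorry`):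
* §1 `additiveControlLeOnTreeAt_of_torsAtomsLe'` — p447721's glue WITHOUT (L10).
* §2 `additiveControlLeOnTreeAt_of_pt_of_kolyvagin` — the control inequality at EVERY frame of the door from
  `poitouTate_selmerStructure_duality` and `kolyvagin` ONLY; `exists_hasCharValuationAt_of_pt_of_kolyvagin` —
  CTL₀ (`X_ac^∅(E_K[p^∞])` is `Λ`-torsion with `f(0) ≠ 0`) at every frame from the same two facts.
* §3 `gordTwoBranchIMC_of_pt_of_kolyvagin_of_typedHalves`, `potMultBranchIMC_of_pt_of_kolyvagin_of_typedHalves`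
  — the typed-halves roads of cruxes r3/r2 re-keyed from `AnticycControlAdditive` (crux r4) to the two facts.
* §4 `stepLManin_of_pt_of_kolyvagin_of_branchIMCs`, `additiveX3RankOneLower_of_printedFacts_of_pt_of_branchIMCs`,
  and **`additiveX3RankOneLower_of_printedFacts_of_pt_of_typedHalves`**: the rung leaf from `PrintedFacts`, ONE
  duality fact, and the typed halves H1/H2/H3 on the two cells — the door's complete residual in one statement.

Closes no item by name; BSD is not advanced beyond the typed reduction. References: [JetchevSkinnerWan2017]
§3.3, §7.4.1 (arXiv:1512.06894 pp. 11–14, 30); [GreenbergLNM1716] §3 Lemma 3.3, §4 Lemma 4.2; [Castella2018]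
Thm. 2.3, §5; [MilneADT2006] I 4.10; [Kolyvagin1990] Thm. A; Keller–Yin arXiv:2410.23241 Thm. 3.5.1 (H3's shape).
-/

noncomputable section

open scoped Classical

open Field NumberField IsDedekindDomain WeierstrassCurve
open Literature.NumberTheory.EllipticCurves Literature.NumberTheory.EllipticCurves.GreenbergSelmer
open Literature.NumberTheory.GaloisRepresentations
open Literature.NumberTheory.GaloisCohomology
open Literature.NumberTheory.EllipticCurves.ModularForms
  Literature.NumberTheory.EllipticCurves.Rank1Residual
  Literature.NumberTheory.EllipticCurves.Rank1Residual.Typed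
  Summit.BirchSwinnertonDyer.Rank1Residual
  Summit.BirchSwinnertonDyer.Rank1Residual.X11b
  Summit.BirchSwinnertonDyer.Rank1Residual.X11b.AcSelmer
  Summit.BirchSwinnertonDyer.Rank1Residual.X11b.LocBridge
  Summit.BirchSwinnertonDyer.BirchSwinnertonDyer.Theorems.SchneiderFree
  Summit.BirchSwinnertonDyer.BirchSwinnertonDyer.Theorems.SchneiderFreeControlAtoms

set_option linter.dupNamespace false

namespace Summit.BirchSwinnertonDyer.BirchSwinnertonDyer.Theorems.SchneiderFreeAdditiveX3

/-! ## §1. The glue in inequality form WITHOUT (L10) -/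

section Glue

variable {W : WeierstrassCurve ℚ} [W.IsElliptic] [W.IsGloballyMinimal] {K : Type} [Field K]
  [NumberField K] {p : ℕ} [Fact p.Prime] {κ : ZpExtension K p}

/-- **T-B6-2 (control INEQUALITY, slack `0`) from (KER-res), `#ker r_𝔭 ≤ p^t`, (P6-add-tors) and (P9-𝓒)
— NO (L10), NO (P11), NO Fin_v.** As `additiveControlLeOnTreeAt_of_torsAtomsLe` with (L10) dropped: the count
gives `Sel^γ` finite, `#Sel^γ · p^g ≤ p^a · p^t · p^{Σ ord_p c_w}`; Greenberg's criterion supplies the torsion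
clause and a witness `n` with `#Sel^γ = p^n · #Sel_γ ≥ p^n`.
[cite: JetchevSkinnerWan2017, Thm. 3.3.1 and §3.3 (arXiv:1512.06894 pp. 11–14)]
[cite: GreenbergLNM1716, §3 Lemma 3.3 (p. 87) and §4 Lemma 4.2 (p. 102)] -/
theorem additiveControlLeOnTreeAt_of_torsAtomsLe' (hK : IsImaginaryQuadratic K) (hsplit : SplitsIn K p)
    (hpN : p ∣ W.conductorNorm ℤ) (hκ : κ.IsAnticyclotomic)
    (γ : absoluteGaloisGroup K) [hγ : Fact (κ.IsTopGenerator γ)] (𝔭 : HeightOneSpectrum (𝓞 K))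
    (h𝔭 : ((p : ℕ) : 𝓞 K) ∈ 𝔭.asIdeal) (ι : K →+* ℚ_[p]) (P : (W.baseChange K).toAffine.Point)
    (g t a : ℕ)
    (hres : Nat.card ((W.baseChange K).resOfLe p (le_top : κ.kerSubgroup ≤ ⊤)).ker = p ^ g)
    (hfin𝔭 : Finite (localKer κ.kerSubgroup ((W.baseChange K).geomPrimaryTorsion p) 𝔭))
    (h𝔭ker : Nat.card (localKer κ.kerSubgroup ((W.baseChange K).geomPrimaryTorsion p) 𝔭) ≤ p ^ t)
    (h6 : (∃ _ : Finite (selmerAcBase (W.baseChange K) p 𝔭 ∅),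
        Nat.card (selmerAcBase (W.baseChange K) p 𝔭 ∅) = p ^ a) ∧
      (a : ℤ) = (padicValNat p
          (Nat.card (AddCommGroup.primaryComponent (W.baseChange K).sha p)) : ℤ) +
        2 * (X11b.padicLogOrd W p ι P - (padicValNat p (AddSubgroup.zmultiples P).index : ℤ)) +
          padicValNat p (X11b.tamagawaProductAbove W K p) + g - t)
    (hloc : ∀ x : Π v : ↥(insert 𝔭 (nPlusPlaces_finite (W := W) (p := p) (K := K) hK.1).toFinset),
        Literature.NumberTheory.EllipticCurves.subgroupH1
          ((⊤ : Subgroup (absoluteGaloisGroup K)) ⊓ decomp (v : HeightOneSpectrum (𝓞 K)))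
          ((W.baseChange K).geomPrimaryTorsion p),
      (∀ v : ↥(insert 𝔭 (nPlusPlaces_finite (W := W) (p := p) (K := K) hK.1).toFinset),
        x v ∈ localKer κ.kerSubgroup ((W.baseChange K).geomPrimaryTorsion p)
          (v : HeightOneSpectrum (𝓞 K))) →
        ∃ c : (W.baseChange K).subgroupH1 p (⊤ : Subgroup (absoluteGaloisGroup K)),
          locAtFinset (W.baseChange K) p _ c = x ∧
          ∀ v : HeightOneSpectrum (𝓞 K), ((p : ℕ) : 𝓞 K) ∉ v.asIdeal → v ∉ (∅ : Set _) →
            v ∉ insert 𝔭 (nPlusPlaces_finite (W := W) (p := p) (K := K) hK.1).toFinset →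
              c ∈ awayKer ⊤ ((W.baseChange K).geomPrimaryTorsion p) v) :
    AdditiveControlLeOnTreeAt p κ 𝔭 γ ι 0 P := by
  have hp : p.Prime := Fact.out
  haveI : IsTotallyComplex K := hK.2
  haveI hEK : (W.baseChange K).IsElliptic := by rw [baseChange]; infer_instance
  obtain ⟨⟨hfinK, hcardK⟩, ha⟩ := h6
  haveI := hfinK
  -- the local kernels at `Σ(N⁺)`: finite, `≤ c_w^{(p)}`, unconditionally
  have h11 : ∀ v ∈ nPlusPlaces W K p,
      Finite (localKer κ.kerSubgroup ((W.baseChange K).geomPrimaryTorsion p) v) ∧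
        Nat.card (localKer κ.kerSubgroup ((W.baseChange K).geomPrimaryTorsion p) v) ≤
          p ^ padicValNat p (((W.baseChange K).baseChange (v.adicCompletion K)).localTamagawaNumber
            (v.adicCompletionIntegers K)) := fun v hv ↦
    natCard_localKer_le_pow_padicValNat_localTamagawaNumber (W.baseChange K) κ
      ((mem_nPlusPlaces_iff v).mp hv).1
  obtain ⟨hfinγ, _, hcount⟩ := natCard_endInvariants_mul_natCard_resKer_eq_nPlus (W := W) hK hκ γ 𝔭
    h𝔭 hfin𝔭 (fun v hv ↦ (h11 v hv).1) hloc
  haveI := hfinγ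
  have hprod : (∏ v ∈ (nPlusPlaces_finite (W := W) (p := p) (K := K) hK.1).toFinset,
      Nat.card (localKer κ.kerSubgroup ((W.baseChange K).geomPrimaryTorsion p) v)) ≤
        p ^ ∑ v ∈ (nPlusPlaces_finite (W := W) (p := p) (K := K) hK.1).toFinset, padicValNat p
          (((W.baseChange K).baseChange (v.adicCompletion K)).localTamagawaNumber
            (v.adicCompletionIntegers K)) := by
    rw [← Finset.prod_pow_eq_pow_sum]
    refine Finset.prod_le_prod (fun _ _ ↦ Nat.zero_le _) fun v hv ↦ ?_
    exact (h11 v ((nPlusPlaces_finite (W := W) (p := p) hK.1).mem_toFinset.mp hv)).2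
  -- `#Sel^γ = p^{n₀}`, and Greenberg's criterion: `#Sel^γ = p^n · #Sel_γ` for the `HasCharValuationAt` witness
  obtain ⟨n₀, hn₀⟩ := AcSelmer.exists_natCard_endInvariants_eq_pow (W.baseChange K) p κ 𝔭 ∅ γ
  obtain ⟨n, hn⟩ := XAc.exists_hasCharValuationAt_of_finite (W.baseChange K) p κ 𝔭 ∅ γ hfinγ
  haveI := X11b.module_finite_XAc_baseChange p κ 𝔭 γ (W := W)
  obtain ⟨_, hcard⟩ := (XAc.hasCharValuationAt_iff_card (W.baseChange K) p κ 𝔭 ∅ γ n).mp hn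
  have hnn₀ : n ≤ n₀ := by
    have hne : Nat.card (IwasawaDual.EndCoinvariants (conjSelmerAc (W.baseChange K) p κ 𝔭 ∅ γ - 1)) ≠ 0 := by
      intro h0
      rw [h0, mul_zero] at hcard
      exact pow_ne_zero n₀ hp.ne_zero (hn₀ ▸ hcard)
    have hle : p ^ n ≤ p ^ n₀ := by
      rw [← hn₀, hcard]
      exact Nat.le_mul_of_pos_right _ (Nat.pos_of_ne_zero hne)
    exact (Nat.pow_le_pow_iff_right hp.one_lt).mp hle
  set σ : ℕ := ∑ v ∈ (nPlusPlaces_finite (W := W) (p := p) (K := K) hK.1).toFinset, padicValNat p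
    (((W.baseChange K).baseChange (v.adicCompletion K)).localTamagawaNumber
      (v.adicCompletionIntegers K)) with hσ
  have hle : p ^ (n₀ + g) ≤ p ^ (a + t + σ) := by
    rw [pow_add, ← hn₀, ← hres, hcount, hcardK, pow_add, pow_add, mul_assoc]
    exact Nat.mul_le_mul_left _ (Nat.mul_le_mul h𝔭ker hprod)
  have hle' : n₀ + g ≤ a + t + σ := (Nat.pow_le_pow_iff_right hp.one_lt).mp hle
  refine ⟨n, hn, ?_⟩
  rw [X11b.padicValNat_tamagawaProductSplit_eq_above_add_sum W p hK.1 hsplit hpN, ← hσ]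
  have hZ : (n : ℤ) + g ≤ a + t + σ := by exact_mod_cast (show n + g ≤ a + t + σ by omega)
  rw [ha] at hZ
  simp only [Nat.cast_add, Nat.cast_zero, mul_zero, add_zero]
  linarith

end Glue

/-! ## §2. The control inequality and CTL₀ at every frame, from Poitou–Tate duality and Kolyvagin ONLY -/

section Facts

open Summit.BirchSwinnertonDyer.BirchSwinnertonDyer.Theses.SchneiderFreeAdditiveX3

/-- **T-B6-2 (`AdditiveControlLeOnTreeAt … 0`) at EVERY frame of the door from TWO cited facts — Poitou–Tate
duality for Selmer structures and Kolyvagin's theorem** (`additiveControlLeOnTreeAt_of_facts` of p447721 with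
(L10), the only consumer of `poitouTate_sha_tateDual`, dropped by §1). CONDITIONAL (hypotheses BY NAME).
[cite: JetchevSkinnerWan2017, Thm. 3.3.1 (arXiv:1512.06894 p. 11)] [cite: MilneADT2006, Ch. I, Thm. 4.10]
[cite: Kolyvagin1990, Thm. A] -/
theorem additiveControlLeOnTreeAt_of_pt_of_kolyvagin
    (hPT : ∀ (K : Type) [Field K] [NumberField K], poitouTate_selmerStructure_duality K)
    (hKo : ∀ (N : ℕ) [NeZero N] (W : WeierstrassCurve ℚ) (K : Type) [Field K] [NumberField K],
      Literature.NumberTheory.EllipticCurves.kolyvagin N W K) :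
    ∀ (W : WeierstrassCurve ℚ) [W.IsElliptic] [W.IsGloballyMinimal] (p : ℕ) [Fact p.Prime],
      W.analyticRank = 1 → p ≠ 2 → ClassX3 W p → Additive.SubSemistableTwist W p →
      ∀ (N : ℕ) [NeZero N] (K : Type) [Field K] [NumberField K]
        (Dt : ModularParametrizationData W N) (H : HeegnerDatum N (NumberField.discr K)) (ι : K →+* ℂ)
        (P : (W.baseChange K).toAffine.Point),
        W.analyticRank = 1 → Additive.N10.Locus W p → W.conductorNorm ℤ = N →
        ∀ hK : IsImaginaryQuadratic K,
        Odd (NumberField.discr K) → ¬ p ∣ Units.torsionOrder K → SatisfiesHeegnerHypothesis N K →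
        (W.quadraticTwist (NumberField.discr K : ℚ)).entireLFunction 1 ≠ 0 →
        WeierstrassCurve.Affine.Point.map ι.toRatAlgHom P = heegnerPointComplex Dt H →
        ¬ IsOfFinAddOrder P →
        ∀ (κ : ZpExtension K p), κ.IsAnticyclotomic →
          ∀ (γ : Field.absoluteGaloisGroup K) [Fact (κ.IsTopGenerator γ)]
            (𝔭 : HeightOneSpectrum (𝓞 K)) (h𝔭 : ((p : ℕ) : 𝓞 K) ∈ 𝔭.asIdeal)
            (he : 𝔭.asIdeal.ramificationIdx (𝓞 ℚ) = 1) (hf : 𝔭.asIdeal.inertiaDeg (𝓞 ℚ) = 1),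
            AdditiveControlLeOnTreeAt p κ 𝔭 γ (embAt K p 𝔭 h𝔭 he hf) 0 P := by
  intro W _ _ p _ hr hp2 hX hS N _ K _ _ Dt H ι P hr' hloc hN hK hodd hunit hHe hL1 hP hnt κ hκ γ _ 𝔭
    h𝔭 he hf
  have hp : p.Prime := Fact.out
  haveI : IsTotallyComplex K := hK.2
  haveI hEK : (W.baseChange K).IsElliptic := by rw [baseChange]; infer_instance
  have hpN : p ∣ W.conductorNorm ℤ := dvd_conductorNorm_of_n10Locus hloc
  have hsplit : SplitsIn K p := splitsIn_of_satisfiesHeegnerHypothesis hN hHe hpN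
  obtain ⟨hrank, hSha⟩ := hKo N W K hK hHe ⟨Dt, H, ι, hP⟩ hnt
  set g := padicValNat p (Nat.card (AddCommGroup.primaryComponent (W.baseChange K).toAffine.Point p))
    with hgdef
  have hcardg := natCard_primaryComponent_point_eq_pow (W.baseChange K) p
  haveI := finite_fixedPoints_kerSubgroup_of_not_dvd_torsionOrder W p κ hp2 hK hunit hκ
  have hres : Nat.card ((W.baseChange K).resOfLe p (le_top : κ.kerSubgroup ≤ ⊤)).ker = p ^ g := by
    rw [natCard_ker_resOfLe_top_eq_natCard_fixedPoints (W.baseChange K) p κ,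
      natCard_fixedPoints_geomPrimaryTorsion_eq_natCard_primaryComponent (W.baseChange K) p, hcardg]
  obtain ⟨tp, htp⟩ := exists_natCard_primaryComponent_padic_eq_pow W p
  obtain ⟨hfin𝔭, hle𝔭⟩ := natCard_localKer_le_natCard_primaryComponent_padic W p κ 𝔭 h𝔭 he hf
  rw [htp] at hle𝔭
  obtain ⟨hfinS, a, hcard, ha⟩ := additiveBaseSelmerCountTors_of_rankOne_anyTorsion W p K (hPT K)
    (fun v ↦ localEulerPoincareCharacteristic_adicCompletionEP K v) hloc.2.1 hK hsplit hrank hSha P hnt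
    𝔭 h𝔭 he hf
  have hcard' : Nat.card (selmerAcBase (W.baseChange K) p 𝔭 ∅) * p ^ tp = p ^ a := by
    rw [← htp]; exact hcard
  have hle : tp ≤ a :=
    (Nat.pow_dvd_pow_iff_le_right hp.one_lt).mp ⟨_, by rw [mul_comm]; exact hcard'.symm⟩
  have hcardSel : Nat.card (selmerAcBase (W.baseChange K) p 𝔭 ∅) = p ^ (a - tp) := by
    have hsplitpow : p ^ a = p ^ (a - tp) * p ^ tp := by rw [← pow_add, Nat.sub_add_cancel hle]
    rw [hsplitpow] at hcard'
    exact Nat.eq_of_mul_eq_mul_right (pow_pos hp.pos tp) hcard'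
  refine additiveControlLeOnTreeAt_of_torsAtomsLe' (W := W) hK hsplit hpN hκ γ 𝔭 h𝔭
    (embAt K p 𝔭 h𝔭 he hf) P g tp (a - tp) hres hfin𝔭 hle𝔭 ⟨⟨hfinS, hcardSel⟩, ?_⟩
    (stub_ptSurj_of_poitouTate hPT hKo W p hr hp2 hX hS N K Dt H ι P hr' hloc hN hK hodd hunit hHe hL1
      hP hnt κ hκ γ 𝔭 h𝔭 he hf)
  rw [Nat.cast_sub hle, ha]

/-- **CTL₀ at EVERY frame of the door from Poitou–Tate duality and Kolyvagin: `X_ac^∅(E_K[p^∞])` over the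
anticyclotomic tower is `Λ`-torsion with a characteristic generator of NON-ZERO constant term** — by control
from the finiteness of `Sel_𝔭(K, E[p^∞])` (rank one + finite `Ш`); the ONLY use the branch cruxes' typed-halves
roads make of the control corner.
[cite: GreenbergLNM1716, §4 Lemma 4.2 (p. 102)] [cite: Castella2018, Thm. 2.3 (arXiv:1704.06608 p. 5)]
[cite: Kolyvagin1990, Thm. A] -/
theorem exists_hasCharValuationAt_of_pt_of_kolyvagin
    (hPT : ∀ (K : Type) [Field K] [NumberField K], poitouTate_selmerStructure_duality K)
    (hKo : ∀ (N : ℕ) [NeZero N] (W : WeierstrassCurve ℚ) (K : Type) [Field K] [NumberField K],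
      Literature.NumberTheory.EllipticCurves.kolyvagin N W K) :
    ∀ (W : WeierstrassCurve ℚ) [W.IsElliptic] [W.IsGloballyMinimal] (p : ℕ) [Fact p.Prime],
      W.analyticRank = 1 → p ≠ 2 → ClassX3 W p → Additive.SubSemistableTwist W p →
      ∀ (N : ℕ) [NeZero N] (K : Type) [Field K] [NumberField K]
        (Dt : ModularParametrizationData W N) (H : HeegnerDatum N (NumberField.discr K)) (ι : K →+* ℂ)
        (P : (W.baseChange K).toAffine.Point),
        W.analyticRank = 1 → Additive.N10.Locus W p → W.conductorNorm ℤ = N → IsImaginaryQuadratic K →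
        Odd (NumberField.discr K) → ¬ p ∣ Units.torsionOrder K → SatisfiesHeegnerHypothesis N K →
        (W.quadraticTwist (NumberField.discr K : ℚ)).entireLFunction 1 ≠ 0 →
        WeierstrassCurve.Affine.Point.map ι.toRatAlgHom P = heegnerPointComplex Dt H →
        ¬ IsOfFinAddOrder P →
        ∀ (κ : ZpExtension K p), κ.IsAnticyclotomic →
          ∀ (γ : Field.absoluteGaloisGroup K) [Fact (κ.IsTopGenerator γ)]
            (𝔭 : HeightOneSpectrum (𝓞 K)), ((p : ℕ) : 𝓞 K) ∈ 𝔭.asIdeal →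
            𝔭.asIdeal.ramificationIdx (𝓞 ℚ) = 1 → 𝔭.asIdeal.inertiaDeg (𝓞 ℚ) = 1 →
            ∃ n : ℕ, XAc.HasCharValuationAt (W.baseChange K) p κ 𝔭 ∅ γ n := by
  intro W _ _ p _ hr hp2 hX hS N _ K _ _ Dt H ι P hr' hloc hN hK hodd hunit hHe hL1 hP hnt κ hκ γ _ 𝔭
    h𝔭 he hf
  obtain ⟨n, hn, -⟩ := additiveControlLeOnTreeAt_of_pt_of_kolyvagin hPT hKo W p hr hp2 hX hS N K Dt H ι
    P hr' hloc hN hK hodd hunit hHe hL1 hP hnt κ hκ γ 𝔭 h𝔭 he hf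
  exact ⟨n, hn⟩

end Facts

/-! ## §3. The typed-halves roads of the branch cruxes, re-keyed from crux r4 to the two facts -/

section Halves

open Summit.BirchSwinnertonDyer.BirchSwinnertonDyer.Theses.SchneiderFreeAdditiveX3

/-- **The additive socket from CTL₀-by-facts and the typed halves (pointwise in `(W, p)` on the cells)**:
`SchneiderFree.additiveIMCLowerBDPInputManinAt_of_halves` with its control hypothesis replaced by the two facts
(§2): H1 ∧ H2 ∧ H3 on a pair of the cells give `AdditiveIMCLowerBDPInputManinAt W p` through the receptacle.
CONDITIONAL; nothing asserted. [cite: Castella2018, §5 (5.1)–(5.3) (arXiv:1704.06608 p. 12)]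
[cite: JetchevSkinnerWan2017, §7.4.1 (arXiv:1512.06894 p. 30)] -/
theorem additiveIMCLowerBDPInputManinAt_of_pt_of_kolyvagin_of_halves
    (hPT : ∀ (K : Type) [Field K] [NumberField K], poitouTate_selmerStructure_duality K)
    (hKo : ∀ (N : ℕ) [NeZero N] (W : WeierstrassCurve ℚ) (K : Type) [Field K] [NumberField K],
      Literature.NumberTheory.EllipticCurves.kolyvagin N W K)
    {W : WeierstrassCurve ℚ} [W.IsElliptic] [W.IsGloballyMinimal] {p : ℕ} [Fact p.Prime]
    (hr : W.analyticRank = 1) (hp2 : p ≠ 2) (hX : ClassX3 W p) (hS : Additive.SubSemistableTwist W p)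
    (h1 : BranchBDPExistsAt W p) (h2 : BranchBDPValueLeAt W p) (h3 : BranchIMCDivAt W p) :
    AdditiveIMCLowerBDPInputManinAt W p := by
  intro N _ K _ _ Dt H ι P hr' hloc hN hK hodd hunit hHe hL hP hnt κ hκ γ _ 𝔭 h𝔭 he hf
  obtain ⟨n, hn⟩ := exists_hasCharValuationAt_of_pt_of_kolyvagin hPT hKo W p hr hp2 hX hS N K Dt H ι P
    hr' hloc hN hK hodd hunit hHe hL hP hnt κ hκ γ 𝔭 h𝔭 he hf
  obtain ⟨ι', hι', ΩK, Ωp, L, hΩK, hΩp, hBDP⟩ :=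
    h1 N K Dt H ι P hr' hloc hN hK hodd hunit hHe hL hP hnt κ hκ γ 𝔭 h𝔭 he hf
  obtain ⟨u, hu⟩ :=
    h2 N K Dt H ι P hr' hloc hN hK hodd hunit hHe hL hP hnt κ hκ γ 𝔭 h𝔭 he hf ι' hι' ΩK Ωp L hΩK hΩp
      hBDP
  have hdiv := h3 N K Dt H ι P hr' hloc hN hK hodd hunit hHe hL hP hnt κ hκ γ 𝔭 h𝔭 he hf ι' hι' ΩK Ωp
    L hΩK hΩp hBDP
  exact additiveIMCLowerBDPOnTreeLeAt_of_value_of_dvd hn hdiv u Dt.c hu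

/-- **`GordTwoBranchIMC` (crux r3, item 19177) ⇐ two facts ∧ H1 ∧ H2 ∧ H3 on the (G-ord, `e = 2`) cell**
(door-c3's `gordTwoBranchIMC_of_anticycControlAdditive_of_typedHalves`, control crux replaced by the two
facts). CONDITIONAL. [cite: KellerYin2024b, Thm. 3.5.1 (arXiv:2410.23241 p. 20) (shape of H3; preprint)] -/
theorem gordTwoBranchIMC_of_pt_of_kolyvagin_of_typedHalves
    (hPT : ∀ (K : Type) [Field K] [NumberField K], poitouTate_selmerStructure_duality K)
    (hKo : ∀ (N : ℕ) [NeZero N] (W : WeierstrassCurve ℚ) (K : Type) [Field K] [NumberField K],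
      Literature.NumberTheory.EllipticCurves.kolyvagin N W K)
    (h1 : ∀ (W : WeierstrassCurve ℚ) [W.IsElliptic] [W.IsGloballyMinimal] (p : ℕ) [Fact p.Prime],
      W.analyticRank = 1 → p ≠ 2 → ClassX3 W p → Additive.SubGordTwo W p → BranchBDPExistsAt W p)
    (h2 : ∀ (W : WeierstrassCurve ℚ) [W.IsElliptic] [W.IsGloballyMinimal] (p : ℕ) [Fact p.Prime],
      W.analyticRank = 1 → p ≠ 2 → ClassX3 W p → Additive.SubGordTwo W p → BranchBDPValueLeAt W p)
    (h3 : ∀ (W : WeierstrassCurve ℚ) [W.IsElliptic] [W.IsGloballyMinimal] (p : ℕ) [Fact p.Prime],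
      W.analyticRank = 1 → p ≠ 2 → ClassX3 W p → Additive.SubGordTwo W p → BranchIMCDivAt W p) :
    GordTwoBranchIMC := by
  intro W _ _ p _ hr hp2 hX hS
  exact additiveIMCLowerBDPInputManinAt_of_pt_of_kolyvagin_of_halves hPT hKo hr hp2 hX (Or.inr hS)
    (h1 W p hr hp2 hX hS) (h2 W p hr hp2 hX hS) (h3 W p hr hp2 hX hS)

/-- **`PotMultBranchIMC` (crux r2, item 19176) ⇐ two facts ∧ H1 ∧ H2 ∧ H3 on the (M) cell** (control crux
replaced by the two facts; on (M) no H3 is in print). CONDITIONAL.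
[cite: KellerYin2024b, §3.1 Case II (arXiv:2410.23241 pp. 13–15) (scope statement only)] -/
theorem potMultBranchIMC_of_pt_of_kolyvagin_of_typedHalves
    (hPT : ∀ (K : Type) [Field K] [NumberField K], poitouTate_selmerStructure_duality K)
    (hKo : ∀ (N : ℕ) [NeZero N] (W : WeierstrassCurve ℚ) (K : Type) [Field K] [NumberField K],
      Literature.NumberTheory.EllipticCurves.kolyvagin N W K)
    (h1 : ∀ (W : WeierstrassCurve ℚ) [W.IsElliptic] [W.IsGloballyMinimal] (p : ℕ) [Fact p.Prime],
      W.analyticRank = 1 → p ≠ 2 → ClassX3 W p → Additive.SubM W p → BranchBDPExistsAt W p)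
    (h2 : ∀ (W : WeierstrassCurve ℚ) [W.IsElliptic] [W.IsGloballyMinimal] (p : ℕ) [Fact p.Prime],
      W.analyticRank = 1 → p ≠ 2 → ClassX3 W p → Additive.SubM W p → BranchBDPValueLeAt W p)
    (h3 : ∀ (W : WeierstrassCurve ℚ) [W.IsElliptic] [W.IsGloballyMinimal] (p : ℕ) [Fact p.Prime],
      W.analyticRank = 1 → p ≠ 2 → ClassX3 W p → Additive.SubM W p → BranchIMCDivAt W p) :
    PotMultBranchIMC := by
  intro W _ _ p _ hr hp2 hX hS
  exact additiveIMCLowerBDPInputManinAt_of_pt_of_kolyvagin_of_halves hPT hKo hr hp2 hX (Or.inl hS)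
    (h1 W p hr hp2 hX hS) (h2 W p hr hp2 hX hS) (h3 W p hr hp2 hX hS)

end Halves

/-! ## §4. The target and the leaf with the MINIMAL fact set -/

section Leaf

open Summit.BirchSwinnertonDyer.BirchSwinnertonDyer.Theses.SchneiderFreeAdditiveX3

/-- **The route's TARGET `StepLManin` from Poitou–Tate duality, Kolyvagin and the two branch cruxes**
(`stepLManin_of_facts_of_branchIMCs` without `poitouTate_sha_tateDual`). [cite: Gross1991, Thm. 1.3] -/
theorem stepLManin_of_pt_of_kolyvagin_of_branchIMCs
    (hPT : ∀ (K : Type) [Field K] [NumberField K], poitouTate_selmerStructure_duality K)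
    (hKo : ∀ (N : ℕ) [NeZero N] (W : WeierstrassCurve ℚ) (K : Type) [Field K] [NumberField K],
      Literature.NumberTheory.EllipticCurves.kolyvagin N W K)
    (h2 : PotMultBranchIMC) (h3 : GordTwoBranchIMC) : StepLManin := by
  intro W _ _ p _ hr hp2 hX hS N _ K _ _ Dt H ι P hr' hloc hN hK hodd hunit hHe hL hP hnt
  have hfin : (W.baseChange K).ShaFinite := (hKo N W K hK hHe ⟨Dt, H, ι, hP⟩ hnt).2
  refine indexLowerBoundLeAt_of_frames_of_shaFinite_le hloc hN hK hHe hfin ?_ ?_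
  · intro κ hκ γ _ 𝔭 h𝔭 he hf
    rcases hS with hM | hG
    · exact h2 W p hr hp2 hX hM N K Dt H ι P hr' hloc hN hK hodd hunit hHe hL hP hnt κ hκ γ 𝔭 h𝔭 he hf
    · exact h3 W p hr hp2 hX hG N K Dt H ι P hr' hloc hN hK hodd hunit hHe hL hP hnt κ hκ γ 𝔭 h𝔭 he hf
  · intro κ hκ γ _ 𝔭 h𝔭 he hf
    exact additiveControlLeOnTreeAt_of_pt_of_kolyvagin hPT hKo W p hr hp2 hX hS N K Dt H ι P hr' hloc hN
      hK hodd hunit hHe hL hP hnt κ hκ γ 𝔭 h𝔭 he hf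

/-- **The rung leaf from `PrintedFacts`, Poitou–Tate duality, and the two branch cruxes** — the route's
`closes` with the control crux r4, the link, and `poitouTate_sha_tateDual` / Brink all removed; the closed
support items discharged by their tree proofs. CONDITIONAL; BSD is not advanced beyond this reduction.
[cite: JetchevSkinnerWan2017, §7.4.1 (arXiv:1512.06894 p. 30)] [cite: MilneADT2006, Ch. I, Thm. 4.10] -/
theorem additiveX3RankOneLower_of_printedFacts_of_pt_of_branchIMCs (hF : PrintedFacts)
    (hPT : ∀ (K : Type) [Field K] [NumberField K], poitouTate_selmerStructure_duality K)
    (h2 : PotMultBranchIMC) (h3 : GordTwoBranchIMC) :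
    Summit.BirchSwinnertonDyer.BirchSwinnertonDyer.Theorems.SchneiderFree.AdditiveX3RankOneLower := by
  have hK : HeegnerTwistData := schneiderFreeAdditiveX3_heegnerTwistData_proof
  have hJ : JointLowerManin := schneiderFreeAdditiveX3_jointLowerManin_proof
  have hU : PartnerUpperRankZero := schneiderFreeAdditiveX3_partnerUpperRankZero_proof
  obtain ⟨hGZ, hKo, hGZK, hmod, hmodD, hCas, hGZ73, hFH, hpar, hHP, hDel, hW16, hWu⟩ := hF
  have hstepL : StepLManin := stepLManin_of_pt_of_kolyvagin_of_branchIMCs hPT hKo h2 h3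
  intro W _ _ p _ hr hp2 hX hS
  have hstep : AdditiveStepLInputManinAt W p := hstepL W p hr hp2 hX hS
  have hdata : HeegnerTwistDataManinAt W p := hK hFH hpar hHP hGZ hmod hmodD W p hr hp2 hX hS
  obtain ⟨N, _, K, _, _, Dt, H, ι, P, Wd, _, _, hN, hKiq, hodd, hunit, hHe, hLtw, hP, hnt, hWd,
    hrd, hXd, hSd⟩ := hdata
  have hloc : Additive.N10.Locus W p :=
    (Additive.N10.locus_iff_cells W p).mpr
      ((Additive.N10.cellM_or_cellGordTwo_of_classX3_of_subSemistableTwist W p hp2 hX hS).elim Or.inl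
        (fun h ↦ Or.inr (Or.inl h)))
  have hidx : IndexLowerBoundLeAt W p K P (padicValNat p Dt.c.natAbs) :=
    hstep N K Dt H ι P hr hloc hN hKiq hodd hunit hHe hLtw hP hnt
  have hJ' : JointLowerBoundAt W Wd p :=
    hJ hGZ hKo hGZK hmod hmodD hCas hGZ73 W p N K Dt H ι P Wd hr hN hKiq hodd hunit hHe hLtw hP hnt hWd
      hrd hp2 hidx
  exact missingLowerBoundAt_of_joint_of_upper hJ' (hU hDel hGZK hmod hmodD hW16 hWu Wd p hrd hp2 hXd hSd)

/-- **THE DOOR'S COMPLETE RESIDUAL IN ONE STATEMENT: the rung leaf `AdditiveX3RankOneLower` from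
`PrintedFacts`, Poitou–Tate duality, and the typed analytic halves H1 (a BDP `p`-adic `L`-function on the
branch exists), H2 (its value at 𝟙 against the Heegner point, Manin-robust) and H3 (`Ch_Λ(X_ac)·R₀⟦T⟧ ⊆ (L)`)
on the (M) cell and on the (G-ord, `e = 2`) cell.** No control crux, no Fin_v, no Brink, no duality for `Ш`.
CONDITIONAL on every displayed hypothesis (H3 on (G-ord) = Keller–Yin Thm. 3.5.1, PREPRINT; (M) not in print);
closes no item by name; BSD is not advanced. [cite: JetchevSkinnerWan2017, §7.4.1 (arXiv:1512.06894 p. 30)] -/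
theorem additiveX3RankOneLower_of_printedFacts_of_pt_of_typedHalves (hF : PrintedFacts)
    (hPT : ∀ (K : Type) [Field K] [NumberField K], poitouTate_selmerStructure_duality K)
    (hM1 : ∀ (W : WeierstrassCurve ℚ) [W.IsElliptic] [W.IsGloballyMinimal] (p : ℕ) [Fact p.Prime],
      W.analyticRank = 1 → p ≠ 2 → ClassX3 W p → Additive.SubM W p → BranchBDPExistsAt W p)
    (hM2 : ∀ (W : WeierstrassCurve ℚ) [W.IsElliptic] [W.IsGloballyMinimal] (p : ℕ) [Fact p.Prime],
      W.analyticRank = 1 → p ≠ 2 → ClassX3 W p → Additive.SubM W p → BranchBDPValueLeAt W p)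
    (hM3 : ∀ (W : WeierstrassCurve ℚ) [W.IsElliptic] [W.IsGloballyMinimal] (p : ℕ) [Fact p.Prime],
      W.analyticRank = 1 → p ≠ 2 → ClassX3 W p → Additive.SubM W p → BranchIMCDivAt W p)
    (hG1 : ∀ (W : WeierstrassCurve ℚ) [W.IsElliptic] [W.IsGloballyMinimal] (p : ℕ) [Fact p.Prime],
      W.analyticRank = 1 → p ≠ 2 → ClassX3 W p → Additive.SubGordTwo W p → BranchBDPExistsAt W p)
    (hG2 : ∀ (W : WeierstrassCurve ℚ) [W.IsElliptic] [W.IsGloballyMinimal] (p : ℕ) [Fact p.Prime],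
      W.analyticRank = 1 → p ≠ 2 → ClassX3 W p → Additive.SubGordTwo W p → BranchBDPValueLeAt W p)
    (hG3 : ∀ (W : WeierstrassCurve ℚ) [W.IsElliptic] [W.IsGloballyMinimal] (p : ℕ) [Fact p.Prime],
      W.analyticRank = 1 → p ≠ 2 → ClassX3 W p → Additive.SubGordTwo W p → BranchIMCDivAt W p) :
    Summit.BirchSwinnertonDyer.BirchSwinnertonDyer.Theorems.SchneiderFree.AdditiveX3RankOneLower := by
  have hKo := hF.2.1
  exact additiveX3RankOneLower_of_printedFacts_of_pt_of_branchIMCs hF hPT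
    (potMultBranchIMC_of_pt_of_kolyvagin_of_typedHalves hPT hKo hM1 hM2 hM3)
    (gordTwoBranchIMC_of_pt_of_kolyvagin_of_typedHalves hPT hKo hG1 hG2 hG3)

end Leaf

end Summit.BirchSwinnertonDyer.BirchSwinnertonDyer.Theorems.SchneiderFreeAdditiveX3

end
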